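/-
Copyright (c) 2026 the pub-hodgecm-mathlib formalisation cell (harness21).  Prover seat hodgecm-mathlib-LH4-p10 (g2), req620 Track A «(D-RAM) FOUR-FRAME» squad
(MS ROAD A, Stage B lead; B10 PART 1 of skeleton `B10-StableCountTypeZero.SKELETON.v1` c61f53438acbd4dd).  2026-09-04.
-/
import Summits.HodgeConjecture.HodgeConjecture.Theorems.F0P3cDyRamDiagonalStrataDefs   -- ★ p855793 (this seat): `HasAxis`, `stratum`
import Mathlib.Algebra.BigOperators.Finprod
import Mathlib.Data.Fintype.BigOperators
import HarnessLib

/-!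
# Crux `H413`, MS ROAD A, STAGE B — B10 PART 1 «PARTITION BY AXIS VECTOR»: the dualisable part of `𝓛₀(T)` summed over the strata of the finite axis box

Cell `hodgecm-mathlib` (D-0151), FLOOR 0, crux item H413 = `stmt-HodgeConjecture-24833`; lane `--supports stmt-HodgeConjecture-24833 --as helper` (count-neutral).  THEOREMS ONLY, generic:
for ANY `σ, ϖ, T`, any weight `f`, any predicate playing the role of «dualisable», if every member of a finite set `S` of lattices has an axis vector in the box `[0, N]³` (B3-α) and
axis vectors are unique (B3-β), then `∑ᶠ_{M ∈ S} f M = Σ_{a ∈ box} ∑ᶠ_{M ∈ S, HasAxis ϖ M a} f M` — the first line of the B10 assembly (then each cell is a brick head).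
* `hasAxis_unique` — axis vectors are unique when `n ↦ |ϖ|ⁿ` is injective (B3-β, proved here once for all: `Pi.single i (ϖ^{aᵢ})` lies in `M`).
* `finsum_mem_eq_sum_box_finsum_mem_hasAxis` — the partition identity.
HONEST LABEL.  Count-neutral; `HC_CM` is proved only modulo the 7 printed citations (2 remaining named inputs: hLiu418 = `stmt-HodgeConjecture-24832`, h413 = `stmt-HodgeConjecture-24833`) until rung 0 closes.

## References
* [Kottwitz1986BaseChangeUnits] R. Kottwitz, *Base change for unit elements of Hecke algebras*, Compositio Math. 60 (1986), §1 pp. 240–241 (counting fixed lattices by position).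
* [Serre1980Trees] J.-P. Serre, *Trees*, Springer (1980), Ch. II §1.1.
-/

set_option autoImplicit false

noncomputable section

namespace Summit.HodgeConjecture.HodgeConjecture.Cruxes.H413.F0P3cDyRamStrataPartition

open Finset
open Summit.HodgeConjecture.HodgeConjecture.Cruxes.H413.F0P3cDyRamDiagonalStrataDefs
open scoped Valued WithZero

variable {K : Type*} [Field K] [Valued K ℤᵐ⁰] {N : ℕ}

/-- **AXIS VECTORS ARE UNIQUE** (`n ↦ |ϖ|ⁿ` order-reversing, i.e. `|ϖ| < 1`, `ϖ ≠ 0`). [cite: Serre1980Trees, Ch. II §1.1] -/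
theorem hasAxis_unique {ϖ : K} (hanti : ∀ m n : ℕ, Valued.v ϖ ^ m ≤ Valued.v ϖ ^ n → n ≤ m)
    {M : Submodule 𝒪[K] (Fin N → K)} {a a' : Fin N → ℕ} (ha : HasAxis ϖ M a) (ha' : HasAxis ϖ M a') : a = a' := by
  funext i
  have h1 : Valued.v (ϖ ^ a i) ≤ Valued.v ϖ ^ a' i := (ha' i (ϖ ^ a i)).1 ((ha i (ϖ ^ a i)).2 (by rw [map_pow]))
  have h2 : Valued.v (ϖ ^ a' i) ≤ Valued.v ϖ ^ a i := (ha i (ϖ ^ a' i)).1 ((ha' i (ϖ ^ a' i)).2 (by rw [map_pow]))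
  rw [map_pow] at h1 h2
  exact le_antisymm (hanti _ _ h2) (hanti _ _ h1)

/-- **PARTITION OF A FINITE SET OF LATTICES BY AXIS VECTOR OVER THE BOX `[0, B]ᴺ`.**  If every `M ∈ S` has an axis vector bounded by `B` and axis vectors are unique, then for any
weight `f`: `∑ᶠ_{M ∈ S} f M = Σ_{a : Fin N → Fin (B+1)} ∑ᶠ_{M ∈ S ∩ HasAxis(a)} f M`. [cite: Kottwitz1986BaseChangeUnits, §1 pp. 240–241] -/
theorem finsum_mem_eq_sum_box_finsum_mem_hasAxis {ϖ : K} (huniq : ∀ (M : Submodule 𝒪[K] (Fin N → K)) (a a' : Fin N → ℕ), HasAxis ϖ M a → HasAxis ϖ M a' → a = a')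
    (S : Set (Submodule 𝒪[K] (Fin N → K))) (hS : S.Finite) (B : ℕ)
    (haxis : ∀ M ∈ S, ∃ a : Fin N → ℕ, HasAxis ϖ M a ∧ ∀ i, a i ≤ B) (f : Submodule 𝒪[K] (Fin N → K) → ℚ) :
    ∑ᶠ M ∈ S, f M = ∑ a : Fin N → Fin (B + 1), ∑ᶠ M ∈ {M | M ∈ S ∧ HasAxis ϖ M (fun i => (a i : ℕ))}, f M := by
  classical
  -- `S` is the disjoint union of the cells over the finite box
  have hcover : S = ⋃ a : Fin N → Fin (B + 1), {M | M ∈ S ∧ HasAxis ϖ M (fun i => (a i : ℕ))} := by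
    ext M
    simp only [Set.mem_iUnion, Set.mem_setOf_eq]
    constructor
    · intro hM
      obtain ⟨a, ha, hle⟩ := haxis M hM
      refine ⟨fun i => ⟨a i, Nat.lt_succ_of_le (hle i)⟩, hM, ?_⟩
      exact ha
    · rintro ⟨a, hM, -⟩; exact hM
  have hdisj : Pairwise fun a a' : Fin N → Fin (B + 1) =>
      Disjoint {M | M ∈ S ∧ HasAxis ϖ M (fun i => (a i : ℕ))} {M | M ∈ S ∧ HasAxis ϖ M (fun i => (a' i : ℕ))} := by
    intro a a' hne
    rw [Set.disjoint_left]
    rintro M ⟨-, ha⟩ ⟨-, ha'⟩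
    apply hne
    funext i
    exact Fin.ext (congrFun (huniq M _ _ ha ha') i)
  have hfin : ∀ a : Fin N → Fin (B + 1), ({M | M ∈ S ∧ HasAxis ϖ M (fun i => (a i : ℕ))} : Set _).Finite :=
    fun a => hS.subset (fun M hM => hM.1)
  conv_lhs => rw [hcover]
  rw [finsum_mem_iUnion hdisj hfin, finsum_eq_sum_of_fintype]

end Summit.HodgeConjecture.HodgeConjecture.Cruxes.H413.F0P3cDyRamStrataPartition

end
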